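import Literature.NumberTheory.Transcendental.ZilberProp112
import Literature.NumberTheory.Transcendental.ZilberQuasiminimalReduction
import Literature.NumberTheory.Transcendental.ZilberFieldQuasiminimalProps
import HarnessLib

/-!
# Consequences of the proof of Bays–Kirby 2018, Prop. 11.2

With `Literature.NumberTheory.Transcendental.BaysKirby2018_prop_11_2_holds` (`ZilberProp112.lean`) the reductions of
`ZilberQuasiminimalReduction.lean` and `ZilberFieldQuasiminimalProps.lean` lose one of their two
named-fact hypotheses:

* `Literature.NumberTheory.Transcendental.isQuasiminimal_of_isExpAlgClosed_of_prop_11_5` — Bays–Kirby's **Theorem 1.5**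
  (`ℂ_exp` exponentially-algebraically closed ⟹ quasiminimal,
  `Literature.NumberTheory.Transcendental.isQuasiminimal_of_isExpAlgClosed`) now rests on Prop. 11.5 (generic Γ-closedness ⟹
  generic strong Γ-closedness over `K`; the weak Zilber–Pink theorem) alone;
* `Literature.NumberTheory.Transcendental.IsZilberField.isQuasiminimal_of_prop_11_5` — likewise for the quasiminimality of
  Zilber fields in all universes;
* `Literature.NumberTheory.Transcendental.IsZilberField.isQuasiminimal_of_gsgc` — and, unconditionally in Prop. 11.5, Zilber
  fields are quasiminimal as soon as uncountable Zilber fields are generically strongly Γ-closed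
  over `ecl ∅`.

## References

* M. Bays, J. Kirby, *Pseudo-exponential maps, variants, and quasiminimality*, Algebra & Number
  Theory 12 (2018) 493–549: Thm 1.3, Thm 1.5, Prop. 11.2, Prop. 11.5, Cor. 11.7.
-/

namespace Literature.NumberTheory.Transcendental

universe u

/-- **Bays–Kirby 2018, Thm 1.5 from Prop. 11.5** (Prop. 11.2 being proved,
`BaysKirby2018_prop_11_2_holds`). [cite: BaysKirby2018ANT, Thm 1.5, Prop. 11.5, Prop. 11.2] -/
theorem isQuasiminimal_of_isExpAlgClosed_of_prop_11_5 (h5 : BaysKirby2018_prop_11_5.{0}) :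
    Transcendental.isQuasiminimal_of_isExpAlgClosed :=
  isQuasiminimal_of_isExpAlgClosed_of_props h5 BaysKirby2018_prop_11_2_holds

/-- **Bays–Kirby 2018, Cor. 11.7 (exponential case) from Prop. 11.5**.
[cite: BaysKirby2018ANT, Cor. 11.7, Prop. 11.5, Prop. 11.2] -/
theorem BaysKirby2018_isQuasiminimal_of_isExpAlgClosed_of_ccp_of_prop_11_5
    (h5 : BaysKirby2018_prop_11_5.{0}) :
    BaysKirby2018_isQuasiminimal_of_isExpAlgClosed_of_ccp.{0} :=
  BaysKirby2018_isQuasiminimal_of_isExpAlgClosed_of_ccp_of_props h5 BaysKirby2018_prop_11_2_holds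

/-- **Zilber fields are quasiminimal, granted Prop. 11.5** (Bays–Kirby 2018, Thm 1.3 via Thm 9.1).
[cite: BaysKirby2018ANT, Thm 1.3, Prop. 11.5, Prop. 11.2] -/
theorem IsZilberField.isQuasiminimal_of_prop_11_5 (h5 : BaysKirby2018_prop_11_5.{u}) :
    IsZilberField.isQuasiminimal.{u} :=
  IsZilberField.isQuasiminimal_of_props h5 BaysKirby2018_prop_11_2_holds

/-- **Zilber fields are quasiminimal as soon as uncountable Zilber fields are generically
strongly Γ-closed over `ecl ∅`** (Prop. 11.2 being proved). [cite: BaysKirby2018ANT, Prop. 11.2, Def. 11.1, Thm 11.6 (proof)] -/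
theorem IsZilberField.isQuasiminimal_of_gsgc
    (hG : ∀ {F : Type u} [Field F] [CharZero F] [Literature.ModelTheory.ExponentialFields.ExponentialRing F]
      [Uncountable F], IsZilberField F →
      GammaField.IsGenericallyStronglyGammaClosedOver (Submodule.span ℚ (ecl (∅ : Set F)))) :
    IsZilberField.isQuasiminimal.{u} :=
  IsZilberField.isQuasiminimal_of_prop_11_2 BaysKirby2018_prop_11_2_holds hG

/-- **The saturation fact from Prop. 11.5 alone.** With Prop. 11.2 proved
(`BaysKirby2018_prop_11_2_holds`) and the density form of Γ-closedness proved
(`BaysKirby2018_gammaPoints_dense_of_isExpAlgClosed_holds`, the Rabinowitsch remark after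
Def. 10.3), the named fact `Literature.NumberTheory.Transcendental.BaysKirby2018_saturation_of_isExpAlgClosed`
of `ZilberSaturation.lean` (Γ-closed ⟹ GΓC ⟹ GSΓC ⟹ `ℵ₀`-saturated for Γ-algebraic extensions
purely Γ-transcendental over a countable `K ◁_cl F`, as used in the proof of Cor. 11.7) rests on
the single named fact `BaysKirby2018_prop_11_5` (Prop. 11.5, GΓC ⟹ GSΓC over `K`: the weak
Zilber–Pink step). [cite: BaysKirby2018ANT, Prop. 11.5, Prop. 11.2, Cor. 11.7 (proof)] -/
theorem BaysKirby2018_saturation_of_isExpAlgClosed_of_prop_11_5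
    (h5 : BaysKirby2018_prop_11_5.{u}) : BaysKirby2018_saturation_of_isExpAlgClosed.{u} :=
  BaysKirby2018_saturation_of_isExpAlgClosed_of_props h5 BaysKirby2018_prop_11_2_holds

end Literature.NumberTheory.Transcendental
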